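import Literature.AlgebraicGeometry.Resolution.WeightedCentreParameterKill
import Literature.AlgebraicGeometry.Resolution.WeightedCentreConjugation
import Literature.AlgebraicGeometry.Resolution.WeightedCentreClassLinearPin
import HarnessLib

/-!
# Kill coordinates: a one-parameter substitution translating a slot and fixing `h` makes `h` free of that slot in graded
# triangular coordinates (engine 1's `W(f)` toy model, RE-DERIVATION-eng1-g44 §3.2 L7 = "ND0 generalised" — an instrument,
# NOT a resolution theorem)

L7 of RE-DERIVATION-eng1-g44 §3.2 (CARVER-NOTES-eng1-g44 §2 "L7 = `NoPureTranslation` GENERALISED", serving THEOREM A⁺ and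
step (L0′) of THEOREM 𝔉′ of the toy model): let `Φ = φ : k[ε] → k[ε][T]` be a `k`-algebra substitution with `h(Φε) = h`
(`φ h = C h`), moving one slot by the parameter, `Φ(ε_y) = ε_y + c·T` (`c ≠ 0`), congruent to the identity modulo `T`
(`[T⁰] Φ(ε_i) = ε_i`), TRIANGULAR (`[T^n] Φ(ε_i)`, `n ≥ 1`, involves only variables of rank `< rk i`) and moving only slots ABOVE
`y` (`rk y < rk i` whenever some `[T^n] Φ(ε_i) ≠ 0`, `n ≥ 1`, `i ≠ y`) — ANY `T`-polynomial data are allowed (flows, tails,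
central `f`-translations).  Substituting `T ↦ -c⁻¹ ε_y` (`WeightedCentreParameterKill`) gives `h = Π″(G)` with `G := h|_{ε_y = 0}`
free of `ε_y` and `Π″ : ε_i ↦ Φ(ε_i)(T := -c⁻¹ ε_y)` (`killSubst`); this file supplies the rest of L7:

* `KillCoordinates.triangular` — a triangular correction family `N` (`vars (N i)` of rank `< rk i`) on a FINITE index type defines
  a `k`-algebra AUTOMORPHISM `Λ_N : ε_i ↦ ε_i + N_i` (composition of the block shears of the rank levels, lowest first; verbatim
  generalisation of `triangularEquiv` of `WeightedCentreNoPureTranslation` from `Fin N` to a finite index type), graded together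
  with its inverse when each `N_i` is homogeneous of the weight of `ε_i` (`isWeightedHomogeneous_triangular(_symm)`);
* `killSubst`, `rk_lt_of_mem_vars_killSubst_sub`, `isWeightedHomogeneous_killSubst` — `Π″` is unipotent triangular, fixes `ε_y` and
  every `Φ`-fixed slot, and is graded when `Φ` is graded with `wt T = w y`;
* `killEquiv` — the KILL COORDINATES `Λ := Λ_{Π″ - id}` (a graded unipotent triangular automorphism with `Λ(ε_i) = Π″(ε_i)`), and
  **`symm_apply_eq_kill`**: `Λ⁻¹ h = h|_{ε_y = 0}`; hence **`notMem_vars_symm_apply`** (`ε_y` does not occur in `Λ⁻¹ h`),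
  **`isInvariantDir_symm_apply`** (`e_y` is an invariant direction of `Λ⁻¹ h`: the TRANSLATION CRITERION of the toy model's (P),
  RE-DERIVATION-eng1-g44 §3.0 (S3), with a FREE parameter — never a partial derivative) and **`not_classPinned_symm_apply`**
  (the class-linear pin condition `(P)_S` of `WeightedCentreClassLinearPin` fails for `Λ⁻¹ h` at `y`, any class `S ∋ y`).

Hypothesis-honest: "(P) fails at `Y`" is delivered in exactly the form (S3) uses it — an explicit graded unipotent triangular
coordinate change after which `h` is free of the slot; which coordinate changes a "(P)-menu" quantifies over is the consumer's
definition.  Instrument for the toy model (cell `pub-rosobs`, carver lane gen 64; AI-written Lean, AI review weaker than expert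
review); NOT a statement about the invariant of [AbramovichTemkinWlodarczyk2024], NOT a resolution theorem.  Substitutions of
polynomial rings [Lang2002, Ch. IV §1]; triangular coordinate changes `y ↦ y + q(u)` [CossartJannsenSaito2020, Def. 8.2 / Thm. 8.16];
the move is the translational blow-up coordinate change of [Hauser2010, §D (p. 12)] read backwards.  Formalisation and statements ours.
-/

namespace Literature.AlgebraicGeometry.Resolution.WeightedBlowup

open MvPolynomial ParameterKill

namespace KillCoordinates

/-! ## Triangular automorphisms on a finite index type -/

section Triangular

variable {k : Type*} [Field k] {ι : Type*} [Fintype ι] [DecidableEq ι] (Nf : ι → MvPolynomial ι k) (rk : ι → ℕ)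

omit [DecidableEq ι] in
/-- A rank function from weights: `rk i = #{j : w j < w i}` is strictly monotone in the weight (bookkeeping; "lighter than").
[cite: CossartJannsenSaito2020, Def. 8.2 / Thm. 8.16] -/
theorem card_filter_lt_lt_of_lt {M : Type*} [LinearOrder M] (w : ι → M) {i j : ι} (h : w j < w i) :
    (Finset.univ.filter fun l => w l < w j).card < (Finset.univ.filter fun l => w l < w i).card := by
  refine Finset.card_lt_card (Finset.ssubset_iff_subset_ne.mpr ⟨fun l hl => ?_, fun heq => ?_⟩)
  · simp only [Finset.mem_filter, Finset.mem_univ, true_and] at hl ⊢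
    exact hl.trans h
  · have hj : j ∈ Finset.univ.filter fun l => w l < w i := Finset.mem_filter.mpr ⟨Finset.mem_univ _, h⟩
    rw [← heq, Finset.mem_filter] at hj
    exact lt_irrefl _ hj.2

omit [DecidableEq ι] in
/-- For a triangular correction family no `N i` with `i` of rank `n` involves a variable of rank `n` (the block-shear hypothesis of a
rank level; bookkeeping). [cite: CossartJannsenSaito2020, Def. 8.2 / Thm. 8.16] -/
theorem level_cond (hrk : ∀ i, ∀ j ∈ (Nf i).vars, rk j < rk i) (n : ℕ) :
    ∀ i ∈ Finset.univ.filter (fun l => rk l = n), ∀ j ∈ (Nf i).vars, j ∉ Finset.univ.filter (fun l => rk l = n) := by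
  intro i hi j hj hjn
  simp only [Finset.mem_filter, Finset.mem_univ, true_and] at hi hjn
  have := hrk i j hj
  omega

/-- The composition of the block shears of the rank levels `0, …, n - 1`, lowest level first (construction).
[cite: CossartJannsenSaito2020, Def. 8.2 / Thm. 8.16] -/
noncomputable def upTo (hrk : ∀ i, ∀ j ∈ (Nf i).vars, rk j < rk i) : ℕ → (MvPolynomial ι k ≃ₐ[k] MvPolynomial ι k)
  | 0 => AlgEquiv.refl
  | n + 1 => (upTo hrk n).trans (blockShear (Finset.univ.filter fun l => rk l = n) Nf (level_cond Nf rk hrk n))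

/-- `upTo n` is the simultaneous substitution `ε_m ↦ ε_m + N_m` on the slots of rank `< n`, the identity on the others
(derived here). [cite: CossartJannsenSaito2020, Def. 8.2 / Thm. 8.16] -/
theorem upTo_X (hrk : ∀ i, ∀ j ∈ (Nf i).vars, rk j < rk i) (n : ℕ) (m : ι) :
    upTo Nf rk hrk n (X m) = if rk m < n then X m + Nf m else X m := by
  induction n with
  | zero => simp [upTo]
  | succ n ih =>
    rw [upTo, AlgEquiv.trans_apply, ih]
    by_cases h1 : rk m < n
    · rw [if_pos h1, blockShear_eq_self, if_pos (Nat.lt_succ_of_lt h1)]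
      intro i hi
      simp only [Finset.mem_filter, Finset.mem_univ, true_and]
      rcases Finset.mem_union.mp (vars_add_subset _ _ hi) with h | h
      · rw [vars_X, Finset.mem_singleton] at h
        rw [h]
        exact h1.ne
      · exact (lt_trans (hrk m i h) h1).ne
    · rw [if_neg h1]
      by_cases h2 : rk m = n
      · have hm : m ∈ Finset.univ.filter fun l => rk l = n := Finset.mem_filter.mpr ⟨Finset.mem_univ m, h2⟩
        rw [blockShear_X_of_mem _ hm, if_pos (by omega)]
      · have hm : m ∉ Finset.univ.filter fun l => rk l = n := fun h => h2 (Finset.mem_filter.mp h).2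
        rw [blockShear_X_of_not_mem _ hm, if_neg (by omega)]

/-- **The triangular automorphism** `Λ_N : ε_m ↦ ε_m + N_m` of a triangular correction family on a finite index type (construction;
`triangularEquiv` of `WeightedCentreNoPureTranslation` for an arbitrary finite index type). [cite: CossartJannsenSaito2020, Def. 8.2 / Thm. 8.16] -/
noncomputable def triangular (hrk : ∀ i, ∀ j ∈ (Nf i).vars, rk j < rk i) : MvPolynomial ι k ≃ₐ[k] MvPolynomial ι k :=
  upTo Nf rk hrk (Finset.univ.sup rk + 1)

/-- `Λ_N (ε_m) = ε_m + N_m` (derived here). [cite: CossartJannsenSaito2020, Def. 8.2 / Thm. 8.16] -/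
theorem triangular_X (hrk : ∀ i, ∀ j ∈ (Nf i).vars, rk j < rk i) (m : ι) : triangular Nf rk hrk (X m) = X m + Nf m := by
  rw [triangular, upTo_X, if_pos]
  exact Nat.lt_succ_of_le (Finset.le_sup (f := rk) (Finset.mem_univ m))

/-- `Λ_N` is the simultaneous substitution `aeval (ε + N)` (derived here). [cite: Lang2002, Ch. IV §1] -/
theorem triangular_apply (hrk : ∀ i, ∀ j ∈ (Nf i).vars, rk j < rk i) (P : MvPolynomial ι k) :
    triangular Nf rk hrk P = aeval (fun i => X i + Nf i) P := by
  have h : (triangular Nf rk hrk : MvPolynomial ι k →ₐ[k] MvPolynomial ι k) = aeval fun i => X i + Nf i :=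
    MvPolynomial.algHom_ext fun i => by rw [AlgEquiv.toAlgHom_apply, triangular_X, aeval_X]
  exact DFunLike.congr_fun h P

/-- **`Λ_N` and `Λ_N⁻¹` are graded** when each `N_i` is homogeneous of the weight of `ε_i` (derived here, from the gradedness of the
block shears and their inverses). [cite: AbramovichTemkinWlodarczyk2024, Lemma 5.2.10 (p. 1577)] -/
theorem isWeightedHomogeneous_upTo {M : Type*} [AddCommMonoid M] (w : ι → M) (hrk : ∀ i, ∀ j ∈ (Nf i).vars, rk j < rk i)
    (hNw : ∀ i, IsWeightedHomogeneous w (Nf i) (w i)) (n : ℕ) {P : MvPolynomial ι k} {m : M} (hP : IsWeightedHomogeneous w P m) :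
    IsWeightedHomogeneous w (upTo Nf rk hrk n P) m ∧ IsWeightedHomogeneous w ((upTo Nf rk hrk n).symm P) m := by
  induction n generalizing P with
  | zero => exact ⟨hP, hP⟩
  | succ n ih =>
    refine ⟨?_, ?_⟩
    · rw [upTo, AlgEquiv.trans_apply]
      exact isWeightedHomogeneous_blockShear w _ (fun i _ => hNw i) (ih hP).1
    · rw [upTo, AlgEquiv.symm_trans_apply]
      exact (ih (isWeightedHomogeneous_blockShear_symm w _ (fun i _ => hNw i) hP)).2

/-- `Λ_N` is graded (derived here). [cite: AbramovichTemkinWlodarczyk2024, Lemma 5.2.10 (p. 1577)] -/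
theorem isWeightedHomogeneous_triangular {M : Type*} [AddCommMonoid M] (w : ι → M) (hrk : ∀ i, ∀ j ∈ (Nf i).vars, rk j < rk i)
    (hNw : ∀ i, IsWeightedHomogeneous w (Nf i) (w i)) {P : MvPolynomial ι k} {m : M} (hP : IsWeightedHomogeneous w P m) :
    IsWeightedHomogeneous w (triangular Nf rk hrk P) m :=
  (isWeightedHomogeneous_upTo Nf rk w hrk hNw _ hP).1

/-- `Λ_N⁻¹` is graded (derived here). [cite: AbramovichTemkinWlodarczyk2024, Lemma 5.2.10 (p. 1577)] -/
theorem isWeightedHomogeneous_triangular_symm {M : Type*} [AddCommMonoid M] (w : ι → M)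
    (hrk : ∀ i, ∀ j ∈ (Nf i).vars, rk j < rk i) (hNw : ∀ i, IsWeightedHomogeneous w (Nf i) (w i)) {P : MvPolynomial ι k} {m : M}
    (hP : IsWeightedHomogeneous w P m) : IsWeightedHomogeneous w ((triangular Nf rk hrk).symm P) m :=
  (isWeightedHomogeneous_upTo Nf rk w hrk hNw _ hP).2

end Triangular

/-! ## The kill substitution `Π″` and the kill coordinates -/

section Kill

variable {k : Type*} [Field k] {ι : Type*} [DecidableEq ι] (φ : MvPolynomial ι k →ₐ[k] Polynomial (MvPolynomial ι k))
  (y : ι) (c : k)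

/-- `Π″ : ε_i ↦ Φ(ε_i)(T := -c⁻¹ ε_y)` for `i ≠ y`, `ε_y ↦ ε_y` (construction; the specialised substitution of
`WeightedCentreParameterKill`). [cite: Lang2002, Ch. IV §1] [cite: Hauser2010, §D (p. 12)] -/
noncomputable def killSubst : ι → MvPolynomial ι k :=
  Function.update (fun i => (φ (X i)).eval (-(C c⁻¹ * X y))) y (X y)

/-- `Π″` fixes `ε_y` (bookkeeping). [cite: Lang2002, Ch. IV §1] -/
@[simp] theorem killSubst_self : killSubst φ y c y = X y := Function.update_self _ _ _

/-- `Π″ (ε_i) = Φ(ε_i)(T := -c⁻¹ ε_y)` for `i ≠ y` (bookkeeping). [cite: Lang2002, Ch. IV §1] -/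
theorem killSubst_of_ne {i : ι} (hi : i ≠ y) : killSubst φ y c i = (φ (X i)).eval (-(C c⁻¹ * X y)) := Function.update_of_ne hi _ _

/-- `Π″` fixes every `Φ`-fixed slot (`Φ(ε_i) = ε_i`, e.g. the slots of `V`, the slots lighter than `Y`, `y₂, …` ; bookkeeping).
[cite: Lang2002, Ch. IV §1] -/
theorem killSubst_of_map_X {i : ι} (hi : φ (X i) = Polynomial.C (X i)) : killSubst φ y c i = X i := by
  by_cases hiy : i = y
  · rw [hiy, killSubst_self]
  · rw [killSubst_of_ne φ y c hiy, hi, Polynomial.eval_C]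

/-- **`h = Π″(h|_{ε_y = 0})`** (the output of `WeightedCentreParameterKill` in this file's notation): `Φ(ε_y) = ε_y + c·T`, `c ≠ 0`,
`φ h = C h`. [cite: Lang2002, Ch. IV §1] [cite: Hauser2010, §D (p. 12)] -/
theorem eq_aeval_killSubst_kill (hc : c ≠ 0) (hy : φ (X y) = Polynomial.C (X y) + Polynomial.C (C c) * Polynomial.X)
    {h : MvPolynomial ι k} (hh : φ h = Polynomial.C h) : h = aeval (killSubst φ y c) (kill y h) := by
  have h0 : (fun i => (φ (X i)).eval (-(C c⁻¹ * X y))) y = 0 := by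
    simp only [hy, Polynomial.eval_add, Polynomial.eval_C, Polynomial.eval_mul, Polynomial.eval_X]
    rw [mul_neg, ← mul_assoc, ← C_mul, mul_inv_cancel₀ hc, C_1, one_mul, add_neg_cancel]
  rw [killSubst, ← AlgHom.comp_apply, aeval_update_comp_kill _ h0]
  exact eq_aeval_eval_of_map_eq_C φ _ hh

/-- **`Π″` is unipotent triangular** (derived here): if `Φ ≡ id (mod T)`, the `T^{≥1}`-coefficients of `Φ(ε_i)` involve only variables
of rank `< rk i`, and only slots above `y` move, then `Π″(ε_i) - ε_i` involves only variables of rank `< rk i`.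
[cite: CossartJannsenSaito2020, Def. 8.2 / Thm. 8.16] -/
theorem rk_lt_of_mem_vars_killSubst_sub (rk : ι → ℕ) (h0 : ∀ i, (φ (X i)).coeff 0 = X i)
    (htri : ∀ i, ∀ n, 1 ≤ n → ∀ j ∈ ((φ (X i)).coeff n).vars, rk j < rk i)
    (hmove : ∀ i, i ≠ y → (∃ n, 1 ≤ n ∧ (φ (X i)).coeff n ≠ 0) → rk y < rk i) (i j : ι)
    (hj : j ∈ (killSubst φ y c i - X i).vars) : rk j < rk i := by
  by_cases hiy : i = y
  · rw [hiy, killSubst_self, sub_self, vars_0] at hj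
    exact absurd hj (Finset.notMem_empty j)
  have hexp : (φ (X i)).eval (-(C c⁻¹ * X y)) - X i
      = ∑ m ∈ Finset.range (φ (X i)).natDegree, (φ (X i)).coeff (m + 1) * (-(C c⁻¹ * X y)) ^ (m + 1) := by
    rw [Polynomial.eval_eq_sum_range' (Nat.lt_succ_self _), Finset.sum_range_succ', h0 i, pow_zero, mul_one, add_sub_cancel_right]
  rw [killSubst_of_ne φ y c hiy, hexp] at hj
  obtain ⟨m, -, hm⟩ := Finset.mem_biUnion.mp (vars_sum_subset _ _ hj)
  by_cases hcm : (φ (X i)).coeff (m + 1) = 0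
  · rw [hcm, zero_mul, vars_0] at hm
    exact absurd hm (Finset.notMem_empty j)
  rcases Finset.mem_union.mp (vars_mul _ _ hm) with h | h
  · exact htri i (m + 1) (Nat.succ_pos m) j h
  · have hjy : j = y := by
      have h' := vars_pow _ _ h
      rw [vars_neg] at h'
      rcases Finset.mem_union.mp (vars_mul _ _ h') with h'' | h''
      · rw [vars_C] at h''
        exact absurd h'' (Finset.notMem_empty j)
      · rwa [vars_X, Finset.mem_singleton] at h''
    rw [hjy]
    exact hmove i hiy ⟨m + 1, Nat.succ_pos m, hcm⟩

/-- **`Π″` is graded** (derived here): if `Φ` is graded with `wt T = w y` (`[T^n] Φ(ε_i)` homogeneous of weight `w i - n·(w y)`), then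
`Π″(ε_i)` is homogeneous of weight `w i`. [cite: AbramovichTemkinWlodarczyk2024, Lemma 5.2.10 (p. 1577)] -/
theorem isWeightedHomogeneous_killSubst {M : Type*} [AddCommGroup M] (w : ι → M)
    (hφw : ∀ i n, IsWeightedHomogeneous w ((φ (X i)).coeff n) (w i - n • w y)) (i : ι) :
    IsWeightedHomogeneous w (killSubst φ y c i) (w i) := by
  by_cases hiy : i = y
  · rw [hiy, killSubst_self]
    exact isWeightedHomogeneous_X k w y
  have hQ : IsWeightedHomogeneous w (-(C c⁻¹ * X y) : MvPolynomial ι k) (w y) := by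
    have h1 := (isWeightedHomogeneous_C w c⁻¹).mul (isWeightedHomogeneous_X k w y)
    rw [zero_add] at h1
    exact (weightedHomogeneousSubmodule k w (w y)).neg_mem h1
  rw [killSubst_of_ne φ y c hiy, Polynomial.eval_eq_sum_range]
  refine IsWeightedHomogeneous.sum _ _ _ fun n _ => ?_
  have h2 := (hφw i n).mul (hQ.pow n)
  rwa [sub_add_cancel] at h2

variable [Fintype ι] (rk : ι → ℕ) (hrk : ∀ i, ∀ j ∈ (killSubst φ y c i - X i).vars, rk j < rk i)

/-- **The kill coordinates** `Λ := Λ_{Π″ - id}`: a unipotent triangular `k`-algebra automorphism of `k[ε]` with `Λ(ε_i) = Π″(ε_i)`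
(construction). [cite: CossartJannsenSaito2020, Def. 8.2 / Thm. 8.16] [cite: Hauser2010, §D (p. 12)] -/
noncomputable def killEquiv : MvPolynomial ι k ≃ₐ[k] MvPolynomial ι k := triangular (fun i => killSubst φ y c i - X i) rk hrk

/-- `Λ(ε_i) = Π″(ε_i)` (derived here). [cite: Lang2002, Ch. IV §1] -/
theorem killEquiv_X (i : ι) : killEquiv φ y c rk hrk (X i) = killSubst φ y c i := by
  rw [killEquiv, triangular_X, add_sub_cancel]

/-- `Λ = aeval Π″` (derived here). [cite: Lang2002, Ch. IV §1] -/
theorem killEquiv_apply (P : MvPolynomial ι k) : killEquiv φ y c rk hrk P = aeval (killSubst φ y c) P := by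
  rw [killEquiv, triangular_apply]
  exact congrArg (fun f => aeval f P) (funext fun i => add_sub_cancel (X i) (killSubst φ y c i))

/-- `Λ` fixes `ε_y` and every `Φ`-fixed slot (derived here). [cite: Lang2002, Ch. IV §1] -/
theorem killEquiv_X_of_map_X {i : ι} (hi : φ (X i) = Polynomial.C (X i)) : killEquiv φ y c rk hrk (X i) = X i := by
  rw [killEquiv_X, killSubst_of_map_X φ y c hi]

/-- `Λ` and `Λ⁻¹` are graded when `Φ` is graded with `wt T = w y` (derived here). [cite: AbramovichTemkinWlodarczyk2024, Lemma 5.2.10 (p. 1577)] -/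
theorem isWeightedHomogeneous_killEquiv {M : Type*} [AddCommGroup M] (w : ι → M)
    (hφw : ∀ i n, IsWeightedHomogeneous w ((φ (X i)).coeff n) (w i - n • w y)) {P : MvPolynomial ι k} {m : M}
    (hP : IsWeightedHomogeneous w P m) :
    IsWeightedHomogeneous w (killEquiv φ y c rk hrk P) m ∧ IsWeightedHomogeneous w ((killEquiv φ y c rk hrk).symm P) m :=
  isWeightedHomogeneous_upTo _ rk w hrk
    (fun i => (weightedHomogeneousSubmodule k w (w i)).sub_mem (isWeightedHomogeneous_killSubst φ y c w hφw i)
      (isWeightedHomogeneous_X k w i)) _ hP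

/-- **`Λ⁻¹ h = h|_{ε_y = 0}`** (derived here): in the kill coordinates `h` is its own restriction to `ε_y = 0`.
[cite: Lang2002, Ch. IV §1] [cite: Hauser2010, §D (p. 12)] -/
theorem symm_apply_eq_kill (hc : c ≠ 0) (hy : φ (X y) = Polynomial.C (X y) + Polynomial.C (C c) * Polynomial.X)
    {h : MvPolynomial ι k} (hh : φ h = Polynomial.C h) : (killEquiv φ y c rk hrk).symm h = kill y h := by
  apply (killEquiv φ y c rk hrk).injective
  rw [AlgEquiv.apply_symm_apply, killEquiv_apply, ← eq_aeval_killSubst_kill φ y c hc hy hh]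

/-- **L7, conclusion (i): `ε_y` does not occur in `Λ⁻¹ h`** (derived here). [cite: Lang2002, Ch. IV §1] [cite: Hauser2010, §D (p. 12)] -/
theorem notMem_vars_symm_apply (hc : c ≠ 0) (hy : φ (X y) = Polynomial.C (X y) + Polynomial.C (C c) * Polynomial.X)
    {h : MvPolynomial ι k} (hh : φ h = Polynomial.C h) : y ∉ ((killEquiv φ y c rk hrk).symm h).vars := by
  rw [symm_apply_eq_kill φ y c rk hrk hc hy hh]
  exact notMem_vars_kill y h

/-- **L7, conclusion (ii) — the TRANSLATION CRITERION**: `e_y` is an invariant direction of `Λ⁻¹ h`, i.e.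
`(Λ⁻¹ h)(ε + t e_y) = Λ⁻¹ h` with `t` FREE (derived here; RE-DERIVATION-eng1-g44 §3.0 (S3)). [cite: Lang2002, Ch. IV §1] -/
theorem isInvariantDir_symm_apply (hc : c ≠ 0) (hy : φ (X y) = Polynomial.C (X y) + Polynomial.C (C c) * Polynomial.X)
    {h : MvPolynomial ι k} (hh : φ h = Polynomial.C h) :
    InvariantDirection.IsInvariantDir ((killEquiv φ y c rk hrk).symm h) (Pi.single y 1) :=
  InvariantDirection.isInvariantDir_single_of_notMem_vars _ (notMem_vars_symm_apply φ y c rk hrk hc hy hh) 1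

/-- **L7, conclusion (iii): the class-linear pin condition `(P)_S` fails for `Λ⁻¹ h` at `y`**, for every class `S ∋ y` (derived here;
`(P)_S` as repaired in `WeightedCentreClassLinearPin`). [cite: Lang2002, Ch. IV §1, Ch. XIII §4] -/
theorem not_classPinned_symm_apply (hc : c ≠ 0) (hy : φ (X y) = Polynomial.C (X y) + Polynomial.C (C c) * Polynomial.X)
    {h : MvPolynomial ι k} (hh : φ h = Polynomial.C h) {S : Finset ι} (hyS : y ∈ S) :
    ¬ InvariantDirection.ClassPinned S ((killEquiv φ y c rk hrk).symm h) y := fun hP =>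
  have hv : (Pi.single y 1 : ι → k) ≠ 0 := fun h0 => by
    have h1 : (Pi.single y 1 : ι → k) y = 0 := by rw [h0, Pi.zero_apply]
    rw [Pi.single_eq_same] at h1
    exact one_ne_zero h1
  hP.not_isInvariantDir hyS hv (fun j hj => Pi.single_eq_of_ne (fun hjy : j = y => hj (by rw [hjy]; exact hyS)) _)
    (isInvariantDir_symm_apply φ y c rk hrk hc hy hh)

end Kill

end KillCoordinates

end Literature.AlgebraicGeometry.Resolution.WeightedBlowup
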